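import Summits.BirchSwinnertonDyer.BirchSwinnertonDyer.Theorems.ResidualThetaTransportAtTwoThetaLayerLambdaCongruenceAtTwoDepletionMonotone
import Literature.NumberTheory.EllipticCurves.LFunctionPrimeCoeff
import HarnessLib

/-!
# Crux `ThetaLayerLambdaCongruenceAtTwo` (stmt-BirchSwinnertonDyer-20688, route ResidualThetaTransportAtTwo), line
# `birth`: the Hecke eigencharacters of the two depleted plus symbols are CONGRUENT modulo the maximal ideal of `ℚ̄₂`
# (width prover bsd-wall-rtt-p3-w2 g0; `--supports stmt-BirchSwinnertonDyer-20688 --as helper`; closes nothing)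

HONEST FRAMING. THEOREMS ONLY, from the crux's own binders; nothing about any curve or form is asserted; BSD is not
proved by any of this.

WHAT. By `…DepletedHecke.lean` / `…CurveEulerHecke.lean` the `S₀`-depleted plus symbols of the partner `g` and of the
curve `W` are eigen for the full Hecke algebra of the depleted level with characters `T_q ↦ ι a_q(g)`, resp.
`T_q ↦ a_q(W)` for primes `q ∉ ℓ(S₀)`, and `U_ℓ ↦ 0` (both) for `ℓ ∈ ℓ(S₀)`. THIS FILE: on the crux's binders these two
characters are CONGRUENT — for every prime `q` outside `ℓ(S₀)`, `‖ι a_q(g) − a_q(W)‖ < 1` (`a_q(W) = W.LFunction q`):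
for `q = 2` both vanish (`cuspCoeff g 2 = 0`, `W.frobeniusTrace 2 = 0` with `2` good for `W`), and for odd `q ∉ ℓ(S₀)`
admissibility of `S₀` (it contains every bad place of `W` and every prime of `M`) gives `q ∤ 2·M·N_W`, where the crux's
`hcong` applies (`a_q(W) = W.frobeniusTrace q` at good `q`, `LFunction_apply_prime_eq_frobeniusTrace`). So the two
depleted eigen-symbols cut out the SAME maximal ideal `𝔪'` of the full Hecke algebra — the multiplicity-one input
of (H-sym) (Vatsal (1.10) / Greenberg–Vatsal (10) read at `2`).

References: [GreenbergVatsal2000] §3 (the two forms give the same maximal ideal); [Vatsal1999] §1;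
[DiamondShurman2005] §8.3.
-/

noncomputable section

-- justification: the `Summit.BirchSwinnertonDyer.BirchSwinnertonDyer.…` path repeats a component (route-file convention)
set_option linter.dupNamespace false

open scoped Classical

open Literature.NumberTheory.EllipticCurves Literature.NumberTheory.EllipticCurves.ModularForms

namespace Summit.BirchSwinnertonDyer.BirchSwinnertonDyer.Theorems.ThetaLayerLambdaCongruenceAtTwo

/-- **Congruence of the two Hecke eigencharacters off `S₀`.** Let `W` have `a₂(W) = 0`, `g` a cusp form
on `Γ₀(M)` with `a₂(g) = 0` whose coefficients are congruent to those of `W` along `ι` off `2·M·N_W` (the crux's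
`hcong`), and `S₀` admissible (every bad place of `W` and every prime of `M` lies in `S₀`). Then for EVERY prime `q`
not among the `ℓ_v`, `v ∈ S₀`: `‖ι a_q(g) − a_q(W)‖ < 1`, `a_q(W) = W.LFunction q`.
[cite: GreenbergVatsal2000, §3 (the congruent forms give the same maximal ideal of the Hecke algebra)] -/
theorem norm_embCoeff_sub_lFunction_lt_one {W : WeierstrassCurve ℚ} [W.IsElliptic] [W.IsGloballyMinimal]
    (ha2 : W.frobeniusTrace 2 = 0) {M : ℕ}
    {g : CuspForm (CongruenceSubgroup.Gamma0 M) 2} (ι : coeffField g →+* PadicAlgCl 2) (hg2 : cuspCoeff g 2 = 0)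
    (hcong : ∀ ℓ : ℕ, ℓ.Prime → ¬ ℓ ∣ 2 * M * W.conductorNorm ℤ →
      ‖embCoeff g ι ℓ - (W.frobeniusTrace ℓ : PadicAlgCl 2)‖ < 1)
    (S₀ : Finset (IsDedekindDomain.HeightOneSpectrum (NumberField.RingOfIntegers ℚ)))
    (hSW : ∀ v : IsDedekindDomain.HeightOneSpectrum (NumberField.RingOfIntegers ℚ), ¬ W.HasGoodReductionAt v → v ∈ S₀)
    (hSM : ∀ v : IsDedekindDomain.HeightOneSpectrum (NumberField.RingOfIntegers ℚ),
      Rat.HeightOneSpectrum.natGenerator v ∣ M → v ∈ S₀)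
    {q : ℕ} (hq : q.Prime) (hqS : ∀ v ∈ S₀, Rat.HeightOneSpectrum.natGenerator v ≠ q) :
    ‖embCoeff g ι q - (W.LFunction q : PadicAlgCl 2)‖ < 1 := by
  -- the place over `q`
  obtain ⟨v, hv⟩ : ∃ v : IsDedekindDomain.HeightOneSpectrum (NumberField.RingOfIntegers ℚ),
      Rat.HeightOneSpectrum.natGenerator v = q :=
    ⟨(Rat.HeightOneSpectrum.primesEquiv (R := NumberField.RingOfIntegers ℚ)).symm ⟨q, hq⟩,
      congrArg Subtype.val ((Rat.HeightOneSpectrum.primesEquiv (R := NumberField.RingOfIntegers ℚ)).apply_symm_apply ⟨q, hq⟩)⟩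
  have hvS : v ∉ S₀ := fun h ↦ hqS v h hv
  have hgood : W.HasGoodReductionAt v := by
    by_contra h; exact hvS (hSW v h)
  have hqM : ¬ q ∣ M := fun h ↦ hvS (hSM v (hv ▸ h))
  haveI : Fact q.Prime := ⟨hq⟩
  -- `a_q(W) = W.frobeniusTrace q` at the good prime `q`
  have hgoodp : W.HasGoodReductionAtPrime q := by
    subst hv
    exact (WeierstrassCurve.hasGoodReductionAtPrime_iff_hasGoodReductionAt_ringOfIntegers v W).mpr hgood
  rw [WeierstrassCurve.LFunction_apply_prime_eq_frobeniusTrace W q hgoodp]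
  by_cases hq2 : q = 2
  · subst hq2
    rw [ha2, embCoeff_def]
    have : (⟨cuspCoeff g 2, coeff_mem_coeffField g 2⟩ : coeffField g) = 0 := Subtype.ext hg2
    rw [this, map_zero, Int.cast_zero, sub_zero, norm_zero]
    exact zero_lt_one
  · refine hcong q hq fun hdvd ↦ ?_
    rcases (Nat.Prime.dvd_mul hq).mp hdvd with h1 | h1
    · rcases (Nat.Prime.dvd_mul hq).mp h1 with h3 | h3
      · exact hq2 ((Nat.prime_dvd_prime_iff_eq hq Nat.prime_two).mp h3)
      · exact hqM h3
    · refine ((WeierstrassCurve.dvd_conductorNorm_iff W v).mp ?_) hgood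
      change Rat.HeightOneSpectrum.natGenerator v ∣ W.conductorNorm ℤ
      rwa [hv]

end Summit.BirchSwinnertonDyer.BirchSwinnertonDyer.Theorems.ThetaLayerLambdaCongruenceAtTwo

end
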